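import Mathlib.AlgebraicGeometry.EllipticCurve.DivisionPolynomial.Basic
import Literature.NumberTheory.EllipticCurves.GaloisAction
import HarnessLib

/-!
# Finiteness of the `2`-torsion of an elliptic curve (Silverman, *AEC*, III.6.4 for `m = 2`)

An elementary, characteristic-free proof that an elliptic curve over a field has only finitely
many points `P` with `2P = O`: a non-zero such point `(x, y)` satisfies `P = -P`, i.e.
`ψ₂(x, y) = 2y + a₁x + a₃ = 0`, hence `Ψ₂Sq(x) = ψ₂(x, y)² - 4·W(x, y) = 0`
(Mathlib `WeierstrassCurve.C_Ψ₂Sq`), and `Ψ₂Sq = 4X³ + b₂X² + 2b₄X + b₆` is a non-zero polynomial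
as soon as `Δ ≠ 0` (if all its coefficients vanish then `Δ = -8b₄³ = -(4)(2b₄)b₄² = 0`); for each
of the finitely many roots `x` there are at most two `y` (roots of the monic quadratic Weierstrass
polynomial at `x`). This is the case `m = 2` of Silverman, *AEC*, Cor. III.6.4 (whose general
case, vendored as the named fact `WeierstrassCurve.finite_torsionPoints`, needs the theory of
isogenies), cf. also *AEC* III.§1–2 and Exercise 3.7 (division polynomials).

## Contents

* `WeierstrassCurve.Ψ₂Sq_ne_zero_of_isElliptic`: `Ψ₂Sq ≠ 0` for an elliptic curve over a field.
* `WeierstrassCurve.isRoot_Ψ₂Sq_of_two_nsmul_eq_zero`: `2 • (x, y) = 0 → Ψ₂Sq(x) = 0`.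
* `WeierstrassCurve.finite_setOf_two_nsmul_eq_zero`: `{P | 2 • P = 0}` is finite.
* `WeierstrassCurve.finite_torsionPoints_two`: the case `n = 2` of the named fact
  `finite_torsionPoints W L` (`Finite (E(L)[2])`), unconditionally.

## References

* J. H. Silverman, *The Arithmetic of Elliptic Curves*, 2nd ed., GTM 106 (2009), III.§2
  (negation formula), Cor. III.6.4, Exercise 3.7.
-/

noncomputable section

open scoped Classical
open Polynomial

universe u

namespace WeierstrassCurve

variable {R : Type u} [Field R] (E : WeierstrassCurve R)

/-- For an elliptic curve over a field, the polynomial `Ψ₂Sq = 4X³ + b₂X² + 2b₄X + b₆` (the square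
of the `2`-division polynomial modulo the Weierstrass equation) is non-zero: if all four
coefficients vanished then `Δ = -8b₄³ = -(4)(2b₄)b₄² = 0` (valid in every characteristic;
Mathlib's `WeierstrassCurve.Ψ₂Sq_ne_zero` assumes `4 ≠ 0` instead). Silverman, *AEC*, III.§1 and
Exercise 3.7. [folklore] -/
theorem Ψ₂Sq_ne_zero_of_isElliptic [E.IsElliptic] : E.Ψ₂Sq ≠ 0 := by
  intro h
  rw [Ψ₂Sq_eq] at h
  have h4 : (4 : R) = 0 := by simpa [twoTorsionPolynomial] using congr_arg (·.coeff 3) h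
  have hb₂ : E.b₂ = 0 := by simpa [twoTorsionPolynomial] using congr_arg (·.coeff 2) h
  have hb₄ : 2 * E.b₄ = 0 := by simpa [twoTorsionPolynomial] using congr_arg (·.coeff 1) h
  have hb₆ : E.b₆ = 0 := by simpa [twoTorsionPolynomial] using congr_arg (·.coeff 0) h
  have hΔ : E.Δ = -(4 * (2 * E.b₄) * E.b₄ ^ 2) := by rw [Δ, hb₂, hb₆]; ring
  rw [h4, zero_mul, zero_mul, neg_zero] at hΔ
  exact E.isUnit_Δ.ne_zero hΔ

/-- If an affine point `P = (x, y)` of a Weierstrass curve over a field satisfies `2P = O`, then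
`P = -P`, so `ψ₂(x, y) = 2y + a₁x + a₃ = 0` and hence `x` is a root of `Ψ₂Sq`
(`Ψ₂Sq = ψ₂² - 4·W(X, Y)`, Mathlib `WeierstrassCurve.C_Ψ₂Sq`). Silverman, *AEC*, III.2.3
(negation formula) and Exercise 3.7(d) for `m = 2`. [folklore] -/
theorem isRoot_Ψ₂Sq_of_two_nsmul_eq_zero {x y : R} (h : E.toAffine.Nonsingular x y)
    (h2 : (2 : ℕ) • Affine.Point.some x y h = 0) : E.Ψ₂Sq.IsRoot x := by
  have hneg : (Affine.Point.some x y h : E.toAffine.Point) = -Affine.Point.some x y h := by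
    rwa [two_nsmul, add_eq_zero_iff_eq_neg] at h2
  rw [Affine.Point.neg_some, Affine.Point.some.injEq] at hneg
  have hy := hneg.2
  have hψ : E.ψ₂.evalEval x y = 0 := by
    rw [ψ₂, Affine.evalEval_polynomialY]
    rw [Affine.negY] at hy
    linear_combination hy
  have heq : E.toAffine.polynomial.evalEval x y = 0 := h.left
  have key := congr_arg (Polynomial.evalEval x y) E.C_Ψ₂Sq
  rw [evalEval_C, evalEval_sub, evalEval_mul, evalEval_pow, hψ, heq, mul_zero,
    zero_pow two_ne_zero, sub_zero] at key
  exact key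

/-- **The `2`-torsion of an elliptic curve over a field is finite**: the set of points `P` with
`2P = O` is finite (the `x`-coordinates of the non-zero ones are roots of the non-zero
polynomial `Ψ₂Sq`, and over each `x` lie at most two points). Silverman, *AEC*, Cor. III.6.4
(case `m = 2`; here with an elementary proof valid in every characteristic). [cite: SilvermanAEC2009, Cor. III.6.4 (m = 2)] -/
theorem finite_setOf_two_nsmul_eq_zero [E.IsElliptic] :
    Set.Finite {P : E.toAffine.Point | (2 : ℕ) • P = 0} := by
  -- candidate coordinates: `x` a root of `Ψ₂Sq`, `y` a root of the Weierstrass polynomial at `x`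
  let T : Set (R × R) :=
    ⋃ x ∈ {x : R | E.Ψ₂Sq.IsRoot x},
      Prod.mk x '' {y : R | (E.toAffine.polynomial.map (evalRingHom x)).IsRoot y}
  have hT : T.Finite := by
    refine (Polynomial.finite_setOf_isRoot E.Ψ₂Sq_ne_zero_of_isElliptic).biUnion fun x _ ↦ ?_
    exact (Polynomial.finite_setOf_isRoot
      (Affine.monic_polynomial.map (evalRingHom x)).ne_zero).image _
  let g : R × R → E.toAffine.Point := fun xy ↦
    if h : E.toAffine.Nonsingular xy.1 xy.2 then Affine.Point.some xy.1 xy.2 h else 0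
  refine ((hT.image g).insert 0).subset ?_
  rintro (_ | ⟨x, y, h⟩) hP
  · exact Set.mem_insert _ _
  · refine Set.mem_insert_of_mem _ ⟨(x, y), ?_, by simp [g, h]⟩
    refine Set.mem_biUnion (E.isRoot_Ψ₂Sq_of_two_nsmul_eq_zero h hP) ⟨y, ?_, rfl⟩
    show (E.toAffine.polynomial.map (evalRingHom x)).IsRoot y
    rw [IsRoot, map_evalRingHom_eval]
    exact h.left

variable {F : Type u} [Field F] (W : WeierstrassCurve F) (L : Type u) [Field L] [Algebra F L]

/-- **`E(L)[2]` is finite** for an elliptic curve `W/F` and any field extension `L/F`: the case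
`n = 2` of the named fact `finite_torsionPoints W L` (Silverman, *AEC*, Cor. III.6.4), proved
unconditionally from `finite_setOf_two_nsmul_eq_zero`. [cite: SilvermanAEC2009, Cor. III.6.4 (m = 2)] -/
theorem finite_torsionPoints_two [W.IsElliptic] : Finite (torsionPoints W L 2) := by
  haveI : (W.baseChange L).IsElliptic := inferInstanceAs (W.map (algebraMap F L)).IsElliptic
  have hfin := (W.baseChange L).finite_setOf_two_nsmul_eq_zero
  refine Set.finite_coe_iff.mpr (hfin.subset fun P hP ↦ ?_)
  have hP' : (2 : ℤ) • P = 0 := (mem_torsionPoints_iff W L P).mp hP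
  show (2 : ℕ) • P = 0
  rw [← natCast_zsmul, Nat.cast_ofNat]
  exact hP'

end WeierstrassCurve
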